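import Literature.AlgebraicGeometry.Motives.MotivatedCycles
import HarnessLib

/-!
# The cup product on `H¹` is alternating: proof of `WeilCohomology.exists_isCupAlternating`

`Literature.AlgebraicGeometry.Motives.MotivatedCycles` records as a named fact
(`WeilCohomology.exists_isCupAlternating : Prop`) that for a Weil cohomology theory `W` and a
smooth projective `X`, the iterated cup product `H¹(X)^g → Hᵍ(X)`,
`(v₀, …, v_{g-1}) ↦ ((1 ∪ v₀) ∪ v₁) ∪ ⋯ ∪ v_{g-1}` (`PreWeilCohomology.cupIter`), is computed by an
alternating `g`-linear map (`PreWeilCohomology.IsCupAlternating`). This file proves it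
(`WeilCohomology.exists_isCupAlternating_holds`). It is kept apart from the sibling
`MotivatedCyclesProofs` (André's `A(X) ⊆ A_mot(X)`), whose Lefschetz-operator imports it does not
need: only `MotivatedCycles` itself is imported.

The statement is a formal consequence of the axioms of a Weil cohomology theory as listed by
Kleiman, *Algebraic cycles and the Weil conjectures* (1968), §1.2: `H•(X)` is an associative,
anticommutative (= graded-commutative) graded `K`-algebra, `K` of characteristic zero — in the
structure `WeilCohomology` these are the fields `cup` (bilinear by type), `cup_assoc`, `cup_comm`
and the standing instance `CharZero K`.

## Proof

* `PreWeilCohomology.exists_multilinearMap_eq_cupIter`: the iterated cup product is computed by a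
  multilinear map, because each `cup h` is bilinear; the map is built by induction on `g` with
  Mathlib's `MultilinearMap.uncurryRight` (no axiom of a Weil cohomology theory is needed).
* `WeilCohomology.cup_comm_of_odd`, `WeilCohomology.cup_self_eq_zero_of_odd`: in odd degrees
  `a ∪ b = -(b ∪ a)` (sign `(-1)^{ij} = -1`), hence `x ∪ x = -(x ∪ x)`, `2 (x ∪ x) = 0` and
  `x ∪ x = 0` as `char K = 0`.
* `WeilCohomology.cupIter_cup_apply_eq_zero`: `(v₀ ∪ ⋯ ∪ v_{g-1}) ∪ vᵢ = 0` for every `i < g`, by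
  induction on `g`, moving `vᵢ` leftwards with `cup_assoc` and anticommutation in degree `1`
  (the mirror image of Mathlib's `ExteriorAlgebra.ι_mul_prod_list`).
* `WeilCohomology.cupIter_eq_zero_of_eq`: hence `cupIter g v = 0` as soon as two coordinates of
  `v` agree (induction on `g`, peeling off the last factor), i.e. the multilinear map is
  alternating, which proves the fact (`exists_isCupAlternating_holds`). The alternating map is
  unique (`PreWeilCohomology.IsCupAlternating.unique`), so nothing is lost by keeping the
  statement existential; this file introduces no definitions.

## References

* S. L. Kleiman, *Algebraic cycles and the Weil conjectures*, in: Dix exposés sur la cohomologie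
  des schémas, Adv. Stud. Pure Math. 3, North-Holland/Masson (1968), 359–386, §1.2 (a Weil
  cohomology theory takes values in anticommutative graded `K`-algebras). [Kleiman1968]
* B. Kahn, *Zeta and L-functions of varieties and motives*, LMS Lecture Note Ser. 462, CUP
  (2020), Def. 3.41 (vi) (§3.4): the Künneth isomorphism "verifies the obvious conditions on
  associativity, unity, and graded commutativity", `x ⊗ y = (-1)^{ij} y ⊗ x` for `x ∈ Hⁱ`,
  `y ∈ Hʲ`; the cup product is induced via the diagonal (§3.5). [Kahn2020]
* N. Bourbaki, *Algèbre*, Ch. III, §7 no. 4 (alternating multilinear maps and the exterior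
  algebra) — the pattern of Mathlib's `ExteriorAlgebra.ιMulti`, followed here.
-/

universe u v

open CategoryTheory AlgebraicGeometry

noncomputable section

namespace Literature.AlgebraicGeometry.Motives

namespace PreWeilCohomology

variable {k : Type u} [Field k] {K : Type v} [Field K] (W : PreWeilCohomology k K)
  (X : SchemeOver k)

/-- The iterated cup product `H¹(X)^g → Hᵍ(X)`, `v ↦ ((1 ∪ v₀) ∪ v₁) ∪ ⋯ ∪ v_{g-1}`
(`PreWeilCohomology.cupIter`), is computed by a `g`-linear map. Induction on `g`: for `g + 1`
take `uncurryRight` of `v' ↦ (f v' ∪ ·)` where `f` computes `cupIter g`. Only the bilinearity of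
each `cup h` is used (Kleiman 1968 §1.2: `H•(X)` is a graded `K`-algebra), so this holds for the
bare data `PreWeilCohomology`, no axiom needed. [folklore] -/
theorem exists_multilinearMap_eq_cupIter : ∀ g : ℕ,
    ∃ f : MultilinearMap K (fun _ : Fin g ↦ W.obj X 1) (W.obj X g),
      ∀ v : Fin g → W.obj X 1, f v = W.cupIter X g v
  | 0 => ⟨MultilinearMap.constOfIsEmpty K _ (W.one X), fun _ ↦ rfl⟩
  | g + 1 => by
    obtain ⟨f, hf⟩ := exists_multilinearMap_eq_cupIter g
    refine ⟨MultilinearMap.uncurryRight (M := fun _ : Fin (g + 1) ↦ W.obj X 1)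
      ((W.cup (rfl : g + 1 = g + 1)).compMultilinearMap f), fun v ↦ ?_⟩
    rw [MultilinearMap.uncurryRight_apply, LinearMap.compMultilinearMap_apply, hf,
      cupIter_succ]
    rfl

end PreWeilCohomology

namespace WeilCohomology

variable {k : Type u} [Field k] {K : Type v} [Field K] [CharZero K] (W : WeilCohomology k K)
variable {n : ℕ} {X : SchemeOver k}

/-- **Anticommutation in odd degrees**: `a ∪ b = -(b ∪ a)` for `a ∈ Hⁱ(X)`, `b ∈ Hʲ(X)` with
`i`, `j` odd, `X` smooth projective (`cup_comm` with sign `(-1)^{ij} = -1`; Kleiman 1968 §1.2,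
"anticommutative"). Here `h`, `h'` are the degree bookkeeping. [folklore] -/
theorem cup_comm_of_odd (hX : IsSmoothProjective n X) {i j m : ℕ} (h : i + j = m)
    (h' : j + i = m) (hi : Odd i) (hj : Odd j) (a : W.obj X i) (b : W.obj X j) :
    W.cup h a b = -W.cup h' b a := by
  rw [W.cup_comm hX h h' a b,
    Int.negOnePow_odd _ (Int.odd_mul.mpr ⟨by exact_mod_cast hi, by exact_mod_cast hj⟩),
    Units.val_neg, Units.val_one, neg_smul, one_smul]

/-- **Odd classes have square zero**: `x ∪ x = 0` for `x ∈ Hⁱ(X)`, `i` odd, `X` smooth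
projective. Indeed `x ∪ x = -(x ∪ x)` by `cup_comm_of_odd`, so `2 • (x ∪ x) = 0`, and `2 ≠ 0`
in `K` (`CharZero K`; Kleiman 1968 §1.2: the coefficient field has characteristic zero). [folklore] -/
theorem cup_self_eq_zero_of_odd (hX : IsSmoothProjective n X) {i m : ℕ} (h : i + i = m)
    (hi : Odd i) (x : W.obj X i) : W.cup h x x = 0 := by
  have hc := W.cup_comm_of_odd hX h h hi hi x x
  have h2 : (2 : K) • W.cup h x x = 0 := by
    rw [two_smul]
    nth_rw 1 [hc]
    exact neg_add_cancel _
  calc W.cup h x x = (2 : K)⁻¹ • ((2 : K) • W.cup h x x) := by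
        rw [smul_smul, inv_mul_cancel₀ two_ne_zero, one_smul]
    _ = 0 := by rw [h2, smul_zero]

/-- **Key lemma** (mirror image of Mathlib's `ExteriorAlgebra.ι_mul_prod_list`): for
`w : Fin g → H¹(X)` and any `i`, `(w₀ ∪ ⋯ ∪ w_{g-1}) ∪ wᵢ = 0` in `Hᵍ⁺¹(X)` (`X` smooth
projective). By induction on `g`: write `w₀ ∪ ⋯ ∪ w_{g} = P ∪ w_g`; if `i = g` then
`(P ∪ w_g) ∪ w_g = P ∪ (w_g ∪ w_g) = 0` (`cup_assoc`, `cup_self_eq_zero_of_odd`); otherwise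
`(P ∪ w_g) ∪ wᵢ = P ∪ (w_g ∪ wᵢ) = -(P ∪ (wᵢ ∪ w_g)) = -((P ∪ wᵢ) ∪ w_g) = 0` by the induction
hypothesis. [folklore] -/
theorem cupIter_cup_apply_eq_zero (hX : IsSmoothProjective n X) :
    ∀ (g : ℕ) (w : Fin g → W.obj X 1) (i : Fin g),
      W.cup (rfl : g + 1 = g + 1) (W.cupIter X g w) (w i) = 0
  | 0, _, i => i.elim0
  | g + 1, w, i => by
    rw [PreWeilCohomology.cupIter_succ,
      W.cup_assoc hX (i := g) (j := 1) (l := 1) rfl rfl rfl (rfl : g + 2 = g + 1 + 1)]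
    cases i using Fin.lastCases with
    | last => rw [W.cup_self_eq_zero_of_odd hX rfl odd_one, map_zero]
    | cast i =>
      rw [W.cup_comm_of_odd hX rfl rfl odd_one odd_one (w (Fin.last g)) (w (Fin.castSucc i)),
        map_neg,
        ← W.cup_assoc hX (i := g) (j := 1) (l := 1) rfl rfl rfl (rfl : g + 2 = g + 1 + 1),
        neg_eq_zero]
      have h0 : W.cup (rfl : g + 1 = g + 1) (W.cupIter X g (w ∘ Fin.castSucc))
          (w (Fin.castSucc i)) = 0 :=
        cupIter_cup_apply_eq_zero hX g (w ∘ Fin.castSucc) i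
      rw [h0, map_zero, LinearMap.zero_apply]

/-- The iterated cup product vanishes on tuples with a repeated entry: if `v i = v j` with
`i ≠ j` then `v₀ ∪ ⋯ ∪ v_{g-1} = 0` (`X` smooth projective). Induction on `g`, peeling off the
last factor: if neither `i` nor `j` is the last index the prefix vanishes by induction; otherwise
this is `cupIter_cup_apply_eq_zero`. (Kleiman 1968 §1.2: `H•(X)` is anticommutative, and
`char K = 0`.) [folklore] -/
theorem cupIter_eq_zero_of_eq (hX : IsSmoothProjective n X) :
    ∀ (g : ℕ) (v : Fin g → W.obj X 1) (i j : Fin g), v i = v j → i ≠ j → W.cupIter X g v = 0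
  | 0, _, i, _, _, _ => i.elim0
  | g + 1, v, i, j, hv, hij => by
    rw [PreWeilCohomology.cupIter_succ]
    cases i using Fin.lastCases with
    | last =>
      cases j using Fin.lastCases with
      | last => exact absurd rfl hij
      | cast j =>
        rw [hv]
        exact W.cupIter_cup_apply_eq_zero hX g (v ∘ Fin.castSucc) j
    | cast i =>
      cases j using Fin.lastCases with
      | last =>
        rw [← hv]
        exact W.cupIter_cup_apply_eq_zero hX g (v ∘ Fin.castSucc) i
      | cast j =>
        have h0 : W.cupIter X g (v ∘ Fin.castSucc) = 0 :=
          cupIter_eq_zero_of_eq hX g (v ∘ Fin.castSucc) i j hv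
            fun h ↦ hij (congrArg Fin.castSucc h)
        rw [h0, map_zero, LinearMap.zero_apply]

/-- **Discharge of the named fact `WeilCohomology.exists_isCupAlternating`** (Kleiman 1968 §1.2:
for a Weil cohomology theory, `H•(X)` is an associative, anticommutative graded `K`-algebra and
`char K = 0`, so the cup product `H¹(X)^g → Hᵍ(X)` is multilinear and alternating): for every
smooth projective `X` and every `g` there is an alternating `g`-linear map `H¹(X)^g → Hᵍ(X)`
computing the iterated cup product — the multilinear map of `exists_multilinearMap_eq_cupIter`,
alternating by `cupIter_eq_zero_of_eq`. [cite: Kleiman1968, §1.2] -/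
theorem exists_isCupAlternating_holds : W.exists_isCupAlternating := by
  intro n X hX g
  obtain ⟨f, hf⟩ := W.exists_multilinearMap_eq_cupIter X g
  exact ⟨{ f with
      map_eq_zero_of_eq' := fun v i j hv hij ↦ by
        change f v = 0
        rw [hf]
        exact W.cupIter_eq_zero_of_eq hX g v i j hv hij }, fun v ↦ hf v⟩

end WeilCohomology

end Literature.AlgebraicGeometry.Motives

end
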